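import Summits.Ventures.Crystal3D.Theorems.StickyWulffConstantCoaxialWallLawRigidTwin
import Summits.Ventures.Crystal3D.Theorems.StickyWulffConstantCoaxialWallLawTranslateAbsorption
import Summits.Ventures.Crystal3D.Theorems.StickyWulffConstantCoaxialWallLawHaggConst
import Summits.Ventures.Crystal3D.Theorems.StickyWulffConstantNoReconstructionGainLatticeAdhesion
import HarnessLib

/-!
# The rigid rung of `stub_coaxialTwoSlabAdhesion` for translation pairs (axis rule as hypothesis)

HONEST FRAMING. Part of the venture `Summits/Ventures/Crystal3D` (cell `crystal3d-full`), helper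
`--supports` the crux `CoaxialWallLaw` (stmt-Ventures-19481, `route-Ventures-StickyWulffConstant`),
REGISTERED line `WallLedgerF` (planner cf-p1 gen 16), stub `stub_coaxialTwoSlabAdhesion`.
RUNG CREDIT ONLY: the stub's inequality under extra hypotheses, not the stub.

Companion of `coaxialTwoSlabAdhesion_rigid_twin` (`…CoaxialWallLawRigidTwin`) for the other kind
of co-axial pair, two TRANSLATES of one lattice: `Λᵢ = Aᵢ·Λ₀ + tᵢ ⊆ L·B(σᵢ) + sᵢ` with both Hägg
words in the fcc letter at `0` (`σ 0 = σ' 0 = 1`, so `Λᵢ = L·Λ₀ + sᵢ`; the case `σ 0 = σ' 0 = −1`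
is the same statement for the frame `L ∘ R`).  Hypotheses beyond the stub's: grains disjoint
(`Λ₁ ∩ Λ₂ = ∅`), RIGID filling (`X ⊆ Λ₁ ∪ Λ₂`), and the AXIS RULE in hypothesis form for the two
pulled-back offsets `L⁻¹(s₂ − s₁)`, `L⁻¹(s₁ − s₂)` (no basal-edged face of the slot cuboctahedron
is face-twinned by the offset — the planner's amendment A of the line card: the defender must
present the pair about the ADAPTED axis; `translate_absorption_inPlane_moved`).

**Theorem (`coaxialTwoSlabAdhesion_rigid_translate`).**  Under these hypotheses the conclusion of
`CoaxialTwoSlabAdhesion` holds for the frame `L` with `R₀ = 3` and an explicit `C`: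
`cross(P₁, X∖P₁) + cross(P₂, Y) ≤ D(Y) + (φ₁ + φ₂ − ½ √(1 − ⟪L e₃, e₃⟫²)) π ρ² + C (1 + h) ρ`
(in fact with `√6/4` for `½`).  Proof: `coaxial_rigid_cell_ledger` with the absorption hypothesis
discharged by `translate_absorption_inPlane_moved`, then `affineSampleDeficit_upper` and the two
`contactDeficiency_sdiff_split` identities, exactly as for twin pairs.

WHAT THIS IS NOT: the existence of an adapted frame (axis rule) is NOT proved here; arbitrary
fillings and CSL offsets are not covered; the stub; rung F-C1 not moved.
-/

noncomputable section

namespace Summit.Ventures.Crystal3D.Theorems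

open Summit.Ventures.Crystal3D Finset
open Literature.MathematicalPhysics.StatisticalMechanics (fccStacking barlowStacking IsHaggSeq
  contactDeficiency)
open scoped InnerProductSpace

/-- **The rigid rung of `stub_coaxialTwoSlabAdhesion`, translation pairs under the axis rule.**
See the module docstring. -/
theorem coaxialTwoSlabAdhesion_rigid_translate
    (A₁ : EuclideanSpace ℝ (Fin 3) ≃ₗᵢ[ℝ] EuclideanSpace ℝ (Fin 3)) (t₁ : EuclideanSpace ℝ (Fin 3))
    (A₂ : EuclideanSpace ℝ (Fin 3) ≃ₗᵢ[ℝ] EuclideanSpace ℝ (Fin 3)) (t₂ : EuclideanSpace ℝ (Fin 3))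
    (L : EuclideanSpace ℝ (Fin 3) ≃ₗᵢ[ℝ] EuclideanSpace ℝ (Fin 3)) (s₁ s₂ : EuclideanSpace ℝ (Fin 3))
    {σ σ' : ℤ → ℤ} (hσ : IsHaggSeq σ) (hσ' : IsHaggSeq σ') (h1 : σ 0 = 1) (h1' : σ' 0 = 1)
    (hsub₁ : (fun q => A₁ q + t₁) '' fccStacking 1 (Real.sqrt (2 / 3)) ⊆
      (fun p => L p + s₁) '' barlowStacking 1 (Real.sqrt (2 / 3)) σ)
    (hsub₂ : (fun q => A₂ q + t₂) '' fccStacking 1 (Real.sqrt (2 / 3)) ⊆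
      (fun p => L p + s₂) '' barlowStacking 1 (Real.sqrt (2 / 3)) σ')
    (hdisj : ∀ p ∈ (fun q => A₁ q + t₁) '' fccStacking 1 (Real.sqrt (2 / 3)),
      p ∉ (fun q => A₂ q + t₂) '' fccStacking 1 (Real.sqrt (2 / 3)))
    (haxis : ∀ w₁ ∈ fccSlots, ∀ w₂ ∈ fccSlots, ∀ w₃ ∈ fccSlots,
      dist w₁ w₂ = 1 → dist w₁ w₃ = 1 → dist w₂ w₃ = 1 → w₁ 2 = 0 →
      (2 / 3 : ℝ) • (w₁ + w₂ + w₃) - L.symm (s₂ - s₁) ∉ fccStacking 1 (Real.sqrt (2 / 3)))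
    (haxis' : ∀ w₁ ∈ fccSlots, ∀ w₂ ∈ fccSlots, ∀ w₃ ∈ fccSlots,
      dist w₁ w₂ = 1 → dist w₁ w₃ = 1 → dist w₂ w₃ = 1 → w₁ 2 = 0 →
      (2 / 3 : ℝ) • (w₁ + w₂ + w₃) - L.symm (s₁ - s₂) ∉ fccStacking 1 (Real.sqrt (2 / 3))) :
    ∃ C R₀ : ℝ, 1 ≤ R₀ ∧ ∀ h : ℝ, 0 ≤ h → ∀ ρ : ℝ, R₀ ≤ ρ →
      ∀ X P₁ P₂ : Finset (EuclideanSpace ℝ (Fin 3)),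
      (∀ p ∈ X, ∀ q ∈ X, p ≠ q → 1 ≤ dist p q) → P₁ ⊆ X → P₂ ⊆ X \ P₁ →
      (∀ p ∈ X, -(2 * R₀) ≤ p 2 ∧ p 2 ≤ h + 2 * R₀ ∧ p 0 ^ 2 + p 1 ^ 2 ≤ ρ ^ 2) →
      (∀ p, p ∈ P₁ ↔ (p ∈ (fun q => A₁ q + t₁) '' fccStacking 1 (Real.sqrt (2 / 3)) ∧
        -(2 * R₀) ≤ p 2 ∧ p 2 ≤ -R₀ ∧ p 0 ^ 2 + p 1 ^ 2 ≤ ρ ^ 2)) →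
      (∀ p, p ∈ P₂ ↔ (p ∈ (fun q => A₂ q + t₂) '' fccStacking 1 (Real.sqrt (2 / 3)) ∧
        h + R₀ ≤ p 2 ∧ p 2 ≤ h + 2 * R₀ ∧ p 0 ^ 2 + p 1 ^ 2 ≤ ρ ^ 2)) →
      (∀ p ∈ X, p ∈ (fun q => A₁ q + t₁) '' fccStacking 1 (Real.sqrt (2 / 3)) ∨
        p ∈ (fun q => A₂ q + t₂) '' fccStacking 1 (Real.sqrt (2 / 3))) →
      ((((P₁ ×ˢ (X \ P₁)).filter fun pq => dist pq.1 pq.2 = 1).card : ℕ) : ℝ) +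
        ((((P₂ ×ˢ ((X \ P₁) \ P₂)).filter fun pq => dist pq.1 pq.2 = 1).card : ℕ) : ℝ) ≤
        contactDeficiency ((X \ P₁) \ P₂) +
          (Real.sqrt 2 / 4 * ∑ᶠ w ∈ {w ∈ fccStacking 1 (Real.sqrt (2 / 3)) | ‖w‖ = 1},
              |⟪w, A₁.symm (EuclideanSpace.single (2 : Fin 3) (1 : ℝ))⟫_ℝ| +
            Real.sqrt 2 / 4 * ∑ᶠ w ∈ {w ∈ fccStacking 1 (Real.sqrt (2 / 3)) | ‖w‖ = 1},
              |⟪w, A₂.symm (EuclideanSpace.single (2 : Fin 3) (1 : ℝ))⟫_ℝ| -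
            (1 / 2 : ℝ) * Real.sqrt (1 - ⟪L (EuclideanSpace.single (2 : Fin 3) (1 : ℝ)),
              (EuclideanSpace.single (2 : Fin 3) (1 : ℝ))⟫_ℝ ^ 2)) * Real.pi * ρ ^ 2 +
          C * (1 + h) * ρ := by
  classical
  obtain ⟨C₁, hC₁⟩ := affineSampleDeficit_upper A₁ t₁ 3 (by norm_num)
  obtain ⟨C₂, hC₂⟩ := affineSampleDeficit_upper A₂ t₂ 3 (by norm_num)
  set Cg : ℝ := 120 * Real.sqrt 2 * Real.pi + 3 / 4 * Real.sqrt 2 * Real.pi * (6 * 3 + 16) +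
    720 * (4 * 3 + 2) with hCg
  refine ⟨|C₁| + |C₂| + Cg, 3, by norm_num, ?_⟩
  intro h hh ρ hρ X P₁ P₂ hX hP₁X hP₂X₁ hcyl hP₁ hP₂ hrigid
  set e₃ : EuclideanSpace ℝ (Fin 3) := EuclideanSpace.single (2 : Fin 3) (1 : ℝ) with he₃
  set φ₁ : ℝ := Real.sqrt 2 / 4 * ∑ᶠ w ∈ {w ∈ fccStacking 1 (Real.sqrt (2 / 3)) | ‖w‖ = 1},
      |⟪w, A₁.symm e₃⟫_ℝ| with hφ₁
  set φ₂ : ℝ := Real.sqrt 2 / 4 * ∑ᶠ w ∈ {w ∈ fccStacking 1 (Real.sqrt (2 / 3)) | ‖w‖ = 1},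
      |⟪w, A₂.symm e₃⟫_ℝ| with hφ₂
  have hP₂X : P₂ ⊆ X := hP₂X₁.trans sdiff_subset
  -- frame normalisation: both grains are translates of `L·Λ₀`
  have e₁ := coaxial_frame_eq_fcc_of_one A₁ t₁ L s₁ hσ hsub₁ h1
  have e₂ := coaxial_frame_eq_fcc_of_one A₂ t₂ L s₂ hσ' hsub₂ h1'
  -- (1) the two slab samples from above (original presentation)
  have hD₁ := hC₁ (-(2 * 3)) (-3) (by norm_num) ρ hρ P₁ hP₁
  have hD₂ := hC₂ (h + 3) (h + 2 * 3) (by ring) ρ hρ P₂ hP₂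
  -- (2) the two-grain cell ledger (normalised presentation), absorption by the axis rule
  have hP₁' := hP₁
  have hP₂' := hP₂
  have hrigid' := hrigid
  have hdisj' := hdisj
  simp only [e₁, e₂] at hP₁' hP₂' hrigid' hdisj'
  have hrigid'' : ∀ p ∈ X, p ∈ (fun q => L q + s₂) '' fccStacking 1 (Real.sqrt (2 / 3)) ∨
      p ∈ (fun q => L q + s₁) '' fccStacking 1 (Real.sqrt (2 / 3)) :=
    fun p hp => (hrigid' p hp).symm
  have habs₁ : ∀ x ∈ X, x ∈ (fun q => L q + s₁) '' fccStacking 1 (Real.sqrt (2 / 3)) →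
      (fccSlots.filter fun w => w 2 = 0 ∧ x + L w ∉ X).card +
        4 * (X.filter fun q => dist x q = 1).card ≤ 48 :=
    fun x _ hxΛ => translate_absorption_inPlane_moved L s₁ s₂ X hX hrigid' x hxΛ (hdisj' x hxΛ) haxis
  have habs₂ : ∀ x ∈ X, x ∈ (fun q => L q + s₂) '' fccStacking 1 (Real.sqrt (2 / 3)) →
      (fccSlots.filter fun w => w 2 = 0 ∧ x + L w ∉ X).card +
        4 * (X.filter fun q => dist x q = 1).card ≤ 48 :=
    fun x _ hxΛ => translate_absorption_inPlane_moved L s₂ s₁ X hX hrigid'' x hxΛ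
      (fun h' => hdisj' x h' hxΛ) haxis'
  have hcell := coaxial_rigid_cell_ledger L s₁ L s₂ X P₁ P₂ 3 h ρ le_rfl hh hρ hX hcyl hP₁X hP₂X
    hP₁' hP₂' hdisj' hrigid' habs₁ habs₂
  -- the face fluxes in the crux's terms
  have hf₁ : Real.sqrt 2 / 4 * ∑ w ∈ fccSlots, |⟪L w, e₃⟫_ℝ| = φ₁ := by
    rw [hφ₁, finsum_unit_fcc_symm_eq_sum_slots, sum_abs_inner_slots_eq_of_movedFcc_eq A₁ L t₁ s₁ e₁]
  have hf₂ : Real.sqrt 2 / 4 * ∑ w ∈ fccSlots, |⟪L w, e₃⟫_ℝ| = φ₂ := by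
    rw [hφ₂, finsum_unit_fcc_symm_eq_sum_slots, sum_abs_inner_slots_eq_of_movedFcc_eq A₂ L t₂ s₂ e₂]
  -- (3) the two splits of the skeleton
  have hs₁ := contactDeficiency_sdiff_split hP₁X
  have hs₂ := contactDeficiency_sdiff_split hP₂X₁
  -- (4) assemble
  set S : ℝ := Real.sqrt (1 - ⟪L e₃, e₃⟫_ℝ ^ 2) with hS
  have hS0 : 0 ≤ S * Real.pi * ρ ^ 2 := by positivity
  have hsix : 2 * (S * Real.pi * ρ ^ 2) ≤ Real.sqrt 6 * (S * Real.pi * ρ ^ 2) :=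
    mul_le_mul_of_nonneg_right two_le_sqrt_six hS0
  have hρ0 : (0 : ℝ) ≤ ρ := by linarith
  have ha : C₁ * ρ ≤ |C₁| * (1 + h) * ρ := by
    have h1 : C₁ * ρ ≤ |C₁| * ρ := mul_le_mul_of_nonneg_right (le_abs_self _) hρ0
    have h2 : 0 ≤ |C₁| * h * ρ := by positivity
    nlinarith
  have hb : C₂ * ρ ≤ |C₂| * (1 + h) * ρ := by
    have h1 : C₂ * ρ ≤ |C₂| * ρ := mul_le_mul_of_nonneg_right (le_abs_self _) hρ0
    have h2 : 0 ≤ |C₂| * h * ρ := by positivity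
    nlinarith
  have hC : (|C₁| + |C₂| + Cg) * (1 + h) * ρ =
      |C₁| * (1 + h) * ρ + |C₂| * (1 + h) * ρ + Cg * (1 + h) * ρ := by ring
  rw [hC]
  rw [hf₁, ← hCg] at hcell
  have hφ12 : φ₂ * Real.pi * ρ ^ 2 = φ₁ * Real.pi * ρ ^ 2 := by rw [← hf₁, ← hf₂]
  linarith [hcell, hD₁, hD₂, hs₁, hs₂, hsix, ha, hb, hS0, hφ12]

end Summit.Ventures.Crystal3D.Theorems

end
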